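import Mathlib

/-!
# drefute g2 — `stub_hull` reduced to a coset-envelope statement (crux PolynomialSlack,
line transport-split-hull; see `DrefuteStubHullG2.md` §3)

Positive-side evidence for the lead/planner (a refuter may not land it; a prover may lift it):
* `HullFamily C`  — verbatim the conclusion of the registered `stub_hull` at exponent `C`;
* `CE80 C`        — the coset-envelope statement, Young form: one coordinate of every
                    `n^{-C}`-dense exactly product-free triple has an 80 %-piece whose one-sided
                    saturation by a Young subgroup `K_c = {k : c ∘ k = c}` with
                    `[S_n : K_c]·(2 n^{C+2} ln n) ≤ √(n!)` creates no products;
* `rank_hulls`    — LEMMA R (fixed envelope `W`, `rank 1_W(x⁻¹z) ≤ r` ⇒ `≤ (|G|+1)^r` exactly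
                    product-free hulls `(X*, W, Z*)` capture every `(X, W, Z)` at 100 %);
* `rank_le_index_of_left_invariant` / `_right_invariant` — one-sided invariance bounds that rank;
* `hullFamily_of_CE80 : CE80 C → HullFamily C` — THE REDUCTION, fully proved (axioms standard);
* `stub_hull_of_CE80` — the same in the VERBATIM shape of the registered `stub_hull`.
-/

set_option linter.dupNamespace false

open Finset

namespace Summit.MatrixMultiplication.MatrixMultiplication.Cruxes.PolynomialSlack.TransportSplitHull.G2

/-- `(A, B, D)` exactly product-free. -/
def PF {G : Type*} [Mul G] [DecidableEq G] (A B D : Finset G) : Prop := ∀ a ∈ A, ∀ b ∈ B, a * b ∉ D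

/-- The conclusion of the registered `stub_hull` at exponent `C` (copied verbatim). -/
def HullFamily (C : ℝ) : Prop := ∃ n₀ : ℕ, ∀ n ≥ n₀,
    ∃ 𝓗 : Finset (Finset (Equiv.Perm (Fin n)) × Finset (Equiv.Perm (Fin n)) ×
        Finset (Equiv.Perm (Fin n))),
      (𝓗.card : ℝ) ≤ Real.exp (Real.sqrt (n.factorial : ℝ) / (n : ℝ) ^ (C + 1)) ∧
      (∀ H ∈ 𝓗, ∀ x ∈ H.1, ∀ y ∈ H.2.1, x * y ∉ H.2.2) ∧
      ∀ X Y Z : Finset (Equiv.Perm (Fin n)),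
        (n.factorial : ℝ) ≤ (X.card : ℝ) * (n : ℝ) ^ C →
        (n.factorial : ℝ) ≤ (Y.card : ℝ) * (n : ℝ) ^ C →
        (n.factorial : ℝ) ≤ (Z.card : ℝ) * (n : ℝ) ^ C →
        (∀ x ∈ X, ∀ y ∈ Y, x * y ∉ Z) →
        ∃ H ∈ 𝓗, 4 * X.card ≤ 5 * (X ∩ H.1).card ∧ 4 * Y.card ≤ 5 * (Y ∩ H.2.1).card ∧
          4 * Z.card ≤ 5 * (Z ∩ H.2.2).card

section perm
variable {n : ℕ}

/-- Label space: a block labelling pattern together with a sign. The subgroup in play is the EVEN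
Young subgroup `K_c⁺ = {k : c ∘ k = c, sign k = 1}`; parity triples `(Odd, Odd, Odd)` refute the
plain-Young version (every nontrivial Young subgroup contains a transposition), so the sign is needed. -/
abbrev Lab (n : ℕ) := (Fin n → Fin n) × ℤˣ

/-- orbit map (left cosets `σK_c⁺` ↔ `(c ∘ σ⁻¹, sign σ)`). -/
def ρR (c : Fin n → Fin n) (σ : Equiv.Perm (Fin n)) : Lab n := (fun i => c (σ⁻¹ i), Equiv.Perm.sign σ)
/-- orbit map (right cosets `K_c⁺σ` ↔ `(c ∘ σ, sign σ)`). -/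
def ρL (c : Fin n → Fin n) (σ : Equiv.Perm (Fin n)) : Lab n := (fun i => c (σ i), Equiv.Perm.sign σ)

/-- `{σ : ρR c σ ∈ 𝒟}` — the right-`K_c⁺`-invariant sets. -/
def WR (c : Fin n → Fin n) (𝒟 : Finset (Lab n)) : Finset (Equiv.Perm (Fin n)) :=
  univ.filter (fun σ => ρR c σ ∈ 𝒟)
/-- `{σ : ρL c σ ∈ 𝒟}` — the left-`K_c⁺`-invariant sets. -/
def WL (c : Fin n → Fin n) (𝒟 : Finset (Lab n)) : Finset (Equiv.Perm (Fin n)) :=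
  univ.filter (fun σ => ρL c σ ∈ 𝒟)

/-- Right saturation `S₀ K_c⁺ = {σ : ρR c σ = ρR c s for some s ∈ S₀}`. -/
def satRight (c : Fin n → Fin n) (S₀ : Finset (Equiv.Perm (Fin n))) : Finset (Equiv.Perm (Fin n)) :=
  WR c (S₀.image (ρR c))
/-- Left saturation `K_c⁺ S₀`. -/
def satLeft (c : Fin n → Fin n) (S₀ : Finset (Equiv.Perm (Fin n))) : Finset (Equiv.Perm (Fin n)) :=
  WL c (S₀.image (ρL c))
/-- `[S_n : K_c⁺]` = size of the orbit of `c` (with signs; at most twice the Young index). -/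
def orbitCard (c : Fin n → Fin n) : ℕ := ((univ : Finset (Equiv.Perm (Fin n))).image (ρR c)).card

end perm

/-- (CE80_C), even-Young form: one coordinate of every `n^{-C}`-dense exactly product-free triple
has an 80 %-piece whose one-sided saturation by an even Young subgroup `K_c⁺ = K_c ∩ A_n` of index
`orbitCard c ≤ √(n!)/(2 n^{C+2} ln n)` creates no products with the other two (full) sets.
(`c` constant gives `K_c⁺ = A_n`: parity triples; point stabilisers / umvirates / Young subgroups of
few blocks give every other known dense product-free mechanism.) -/
def CE80 (C : ℝ) : Prop := ∃ n₁ : ℕ, ∀ n ≥ n₁, ∀ X Y Z : Finset (Equiv.Perm (Fin n)),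
    (n.factorial : ℝ) ≤ (X.card : ℝ) * (n : ℝ) ^ C →
    (n.factorial : ℝ) ≤ (Y.card : ℝ) * (n : ℝ) ^ C →
    (n.factorial : ℝ) ≤ (Z.card : ℝ) * (n : ℝ) ^ C →
    PF X Y Z →
    ∃ c : Fin n → Fin n,
      (orbitCard c : ℝ) * (2 * (n : ℝ) ^ (C + 2) * Real.log n) ≤ Real.sqrt (n.factorial : ℝ) ∧
      ((∃ X₀ ⊆ X, 4 * X.card ≤ 5 * X₀.card ∧ (PF (satRight c X₀) Y Z ∨ PF (satLeft c X₀) Y Z)) ∨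
       (∃ Y₀ ⊆ Y, 4 * Y.card ≤ 5 * Y₀.card ∧ (PF X (satRight c Y₀) Z ∨ PF X (satLeft c Y₀) Z)) ∨
       (∃ Z₀ ⊆ Z, 4 * Z.card ≤ 5 * Z₀.card ∧ (PF X Y (satRight c Z₀) ∨ PF X Y (satLeft c Z₀))))

/-! ## Linear algebra: the convolution matrix and generic rank bounds -/

/-- `A_W(x,z) = 1_W(x⁻¹ z)` over `ℚ`. -/
def convMatrix {G : Type*} [Group G] [DecidableEq G] (W : Finset G) : Matrix G G ℚ :=
  Matrix.of fun x z => if x⁻¹ * z ∈ W then 1 else 0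

@[simp] theorem convMatrix_apply {G : Type*} [Group G] [DecidableEq G] (W : Finset G) (x z : G) :
    convMatrix W x z = if x⁻¹ * z ∈ W then 1 else 0 := rfl

section generic
variable {m k β : Type*} [Fintype m] [Fintype k] [DecidableEq β]

/-- If the rows of `A` factor through `φ`, then `rank A ≤ #image φ`. -/
theorem rank_le_card_image_of_rows (A : Matrix m k ℚ) (φ : m → β) (F : β → (k → ℚ))
    (h : ∀ x, A x = F (φ x)) : A.rank ≤ ((univ : Finset m).image φ).card := by
  classical
  rw [Matrix.rank_eq_finrank_span_row]
  set T : Finset (k → ℚ) := ((univ : Finset m).image φ).image F with hTdef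
  have hsub : Set.range A.row ⊆ (T : Set (k → ℚ)) := by
    rintro v ⟨x, rfl⟩
    have : A.row x = F (φ x) := h x
    rw [this, hTdef]
    simp only [coe_image, coe_univ, Set.image_univ]
    exact ⟨φ x, Set.mem_range_self x, rfl⟩
  calc Module.finrank ℚ (Submodule.span ℚ (Set.range A.row))
      ≤ Module.finrank ℚ (Submodule.span ℚ (T : Set (k → ℚ))) :=
        Submodule.finrank_mono (Submodule.span_mono hsub)
    _ ≤ T.card := by simpa using finrank_span_le_card (R := ℚ) (T : Set (k → ℚ))
    _ ≤ ((univ : Finset m).image φ).card := card_image_le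

/-- If the columns of `A` factor through `φ`, then `rank A ≤ #image φ`. -/
theorem rank_le_card_image_of_cols (A : Matrix m k ℚ) (φ : k → β) (F : β → (m → ℚ))
    (h : ∀ z, (fun x => A x z) = F (φ z)) : A.rank ≤ ((univ : Finset k).image φ).card := by
  rw [← Matrix.rank_transpose]
  refine rank_le_card_image_of_rows (Matrix.transpose A) φ F (fun z => ?_)
  ext x
  have := congrFun (h z) x
  simpa using this

end generic

section aux

theorem sum_choose_le_pow (N r : ℕ) : ∑ k ∈ range (r + 1), N.choose k ≤ (N + 1) ^ r := by
  induction r with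
  | zero => simp
  | succ r ih =>
    rw [Finset.sum_range_succ, pow_succ]
    have h1 : N.choose (r + 1) ≤ N ^ (r + 1) := Nat.choose_le_pow N (r + 1)
    have h2 : N ^ (r + 1) ≤ (N + 1) ^ r * N := by
      rw [pow_succ]
      exact Nat.mul_le_mul_right _ (Nat.pow_le_pow_left (Nat.le_succ N) r)
    calc ∑ k ∈ range (r + 1), N.choose k + N.choose (r + 1)
        ≤ (N + 1) ^ r + (N + 1) ^ r * N := Nat.add_le_add ih (h1.trans h2)
      _ = (N + 1) ^ r * (N + 1) := by ring

/-- The number of subsets of size `≤ r` of an `N`-set is at most `(N+1)^r`. -/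
theorem card_filter_card_le {α : Type*} [Fintype α] [DecidableEq α] (r : ℕ) :
    ((univ : Finset α).powerset.filter (fun S => S.card ≤ r)).card ≤ (Fintype.card α + 1) ^ r := by
  have hsub : (univ : Finset α).powerset.filter (fun S => S.card ≤ r) ⊆
      (range (r + 1)).biUnion (fun k => powersetCard k (univ : Finset α)) := by
    intro S hS
    simp only [mem_filter, mem_powerset] at hS
    simp only [mem_biUnion, mem_range, mem_powersetCard]
    exact ⟨S.card, Nat.lt_succ_of_le hS.2, hS.1, rfl⟩
  calc ((univ : Finset α).powerset.filter (fun S => S.card ≤ r)).card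
      ≤ ((range (r + 1)).biUnion (fun k => powersetCard k (univ : Finset α))).card :=
        card_le_card hsub
    _ ≤ ∑ k ∈ range (r + 1), (powersetCard k (univ : Finset α)).card := card_biUnion_le
    _ = ∑ k ∈ range (r + 1), (Fintype.card α).choose k := by
        simp [card_powersetCard, Finset.card_univ]
    _ ≤ (Fintype.card α + 1) ^ r := sum_choose_le_pow _ _

end aux

/-! ## Lemma R -/

section rankHulls
open Pointwise

variable {G : Type*} [Group G] [Fintype G] [DecidableEq G]

/-- `Z*(S)`: common zeros of the rows indexed by `S`. -/
def Zstar (W S : Finset G) : Finset G := univ.filter (fun z => ∀ x ∈ S, convMatrix W x z = 0)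

/-- `X*(S)`: rows vanishing on all of `Z*(S)`. -/
def Xstar (W S : Finset G) : Finset G := univ.filter (fun x => ∀ z ∈ Zstar W S, convMatrix W x z = 0)

theorem pf_Xstar_Zstar (W S : Finset G) : PF (Xstar W S) W (Zstar W S) := by
  intro x hx y hy hxy
  simp only [Xstar, mem_filter, mem_univ, true_and] at hx
  have h := hx (x * y) hxy
  simp [convMatrix_apply, hy] at h

/-- The hull pairs `(X*(S), Z*(S))`, `|S| ≤ r`. -/
def hullPairs (W : Finset G) (r : ℕ) : Finset (Finset G × Finset G) :=
  ((univ : Finset G).powerset.filter (fun S => S.card ≤ r)).image (fun S => (Xstar W S, Zstar W S))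

theorem card_hullPairs_le (W : Finset G) (r : ℕ) :
    (hullPairs W r).card ≤ (Fintype.card G + 1) ^ r :=
  card_image_le.trans (card_filter_card_le r)

theorem pf_of_mem_hullPairs {W : Finset G} {r : ℕ} {H : Finset G × Finset G}
    (hH : H ∈ hullPairs W r) : PF H.1 W H.2 := by
  simp only [hullPairs, mem_image] at hH
  obtain ⟨S, -, rfl⟩ := hH
  exact pf_Xstar_Zstar W S

theorem exists_mem_hullPairs {W : Finset G} {r : ℕ} (hr : (convMatrix W).rank ≤ r)
    {X Z : Finset G} (hXZ : PF X W Z) : ∃ H ∈ hullPairs W r, X ⊆ H.1 ∧ Z ⊆ H.2 := by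
  classical
  set A := convMatrix W with hA
  let t : Set (G → ℚ) := (fun x => A x) '' (X : Set G)
  obtain ⟨b, hbt, -, htb, hbli⟩ :=
    exists_linearIndepOn_id_extension (linearIndepOn_empty ℚ id) (Set.empty_subset t)
  have htfin : t.Finite := (X.finite_toSet).image _
  have hbfin : b.Finite := htfin.subset hbt
  have hpre : ∀ v ∈ hbfin.toFinset, ∃ x ∈ X, A x = v := by
    intro v hv
    rw [Set.Finite.mem_toFinset] at hv
    obtain ⟨x, hx, rfl⟩ := hbt hv
    exact ⟨x, hx, rfl⟩
  choose! g hgX hgA using hpre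
  set S : Finset G := hbfin.toFinset.image g with hS
  have hSX : S ⊆ X := by
    intro s hs
    rw [hS, mem_image] at hs
    obtain ⟨v, hv, rfl⟩ := hs
    exact hgX v hv
  have hbcard : hbfin.toFinset.card ≤ r := by
    have hli : LinearIndepOn ℚ id ((hbfin.toFinset : Finset (G → ℚ)) : Set (G → ℚ)) := by
      simpa using hbli
    have h1 : Module.finrank ℚ (Submodule.span ℚ ((hbfin.toFinset : Finset (G → ℚ)) : Set (G → ℚ)))
        = hbfin.toFinset.card := finrank_span_finset_eq_card hli
    have h2 : Submodule.span ℚ ((hbfin.toFinset : Finset (G → ℚ)) : Set (G → ℚ)) ≤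
        Submodule.span ℚ (Set.range A.row) := by
      apply Submodule.span_mono
      intro v hv
      have hv' : v ∈ b := by simpa using hv
      obtain ⟨x, -, rfl⟩ := hbt hv'
      exact ⟨x, rfl⟩
    have h3 := Submodule.finrank_mono h2
    rw [h1, ← Matrix.rank_eq_finrank_span_row] at h3
    exact h3.trans hr
  have hScard : S.card ≤ r := (card_image_le).trans hbcard
  refine ⟨(Xstar W S, Zstar W S), ?_, ?_, ?_⟩
  · exact mem_image.mpr ⟨S, mem_filter.mpr ⟨mem_powerset.mpr (subset_univ _), hScard⟩, rfl⟩
  · intro x hx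
    simp only [Xstar, mem_filter, mem_univ, true_and]
    intro z hz
    simp only [Zstar, mem_filter, mem_univ, true_and] at hz
    have hxspan : A x ∈ Submodule.span ℚ b := htb ⟨x, hx, rfl⟩
    have hbS : ∀ v ∈ b, v z = 0 := by
      intro v hv
      have hv' : v ∈ hbfin.toFinset := by simpa using hv
      have h0 := hz (g v) (mem_image_of_mem g hv')
      have e := congrFun (hgA v hv') z
      simp only [hA] at e
      rw [← e]
      exact h0
    have key : ∀ w ∈ Submodule.span ℚ b, w z = 0 := by
      intro w hw
      induction hw using Submodule.span_induction with
      | mem v hv => exact hbS v hv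
      | zero => rfl
      | add u v _ _ hu hv => simp [hu, hv]
      | smul c v _ hv => simp [hv]
    simpa [hA] using key (A x) hxspan
  · intro z hz
    simp only [Zstar, mem_filter, mem_univ, true_and]
    intro s hs
    have hsX := hSX hs
    simp only [convMatrix_apply, ite_eq_right_iff, one_ne_zero, imp_false]
    intro hw
    have := hXZ s hsX (s⁻¹ * z) hw
    rw [mul_inv_cancel_left] at this
    exact this hz

/-- LEMMA R (fixed-envelope rank lemma), middle-coordinate form. -/
theorem rank_hulls (W : Finset G) (r : ℕ) (hr : (convMatrix W).rank ≤ r) :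
    ∃ 𝓗 : Finset (Finset G × Finset G),
      𝓗.card ≤ (Fintype.card G + 1) ^ r ∧
      (∀ H ∈ 𝓗, PF H.1 W H.2) ∧
      ∀ X Z : Finset G, PF X W Z → ∃ H ∈ 𝓗, X ⊆ H.1 ∧ Z ⊆ H.2 :=
  ⟨hullPairs W r, card_hullPairs_le W r, fun _ hH => pf_of_mem_hullPairs hH,
    fun _ _ hXZ => exists_mem_hullPairs hr hXZ⟩

/-! ### The three coordinate forms of the hull family -/

/-- hulls `(X*, W, Z*)` — `W` is the middle set. -/
def famMid (W : Finset G) (r : ℕ) : Finset (Finset G × Finset G × Finset G) :=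
  (hullPairs W r).image (fun p => (p.1, W, p.2))
/-- hulls `(W, X*⁻¹, Z*⁻¹)` — `W` is the first set (via `PF W Y Z ↔ PF Y⁻¹ W⁻¹ Z⁻¹`). -/
def famFirst (W : Finset G) (r : ℕ) : Finset (Finset G × Finset G × Finset G) :=
  (hullPairs W⁻¹ r).image (fun p => (W, p.1⁻¹, p.2⁻¹))
/-- hulls `(X*⁻¹, Z*, W)` — `W` is the third set (via `PF X Y W ↔ PF X⁻¹ W Y`). -/
def famThird (W : Finset G) (r : ℕ) : Finset (Finset G × Finset G × Finset G) :=
  (hullPairs W r).image (fun p => (p.1⁻¹, p.2, W))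

theorem card_famMid_le (W : Finset G) (r : ℕ) : (famMid W r).card ≤ (Fintype.card G + 1) ^ r :=
  card_image_le.trans (card_hullPairs_le W r)
theorem card_famFirst_le (W : Finset G) (r : ℕ) : (famFirst W r).card ≤ (Fintype.card G + 1) ^ r :=
  card_image_le.trans (card_hullPairs_le W⁻¹ r)
theorem card_famThird_le (W : Finset G) (r : ℕ) : (famThird W r).card ≤ (Fintype.card G + 1) ^ r :=
  card_image_le.trans (card_hullPairs_le W r)

theorem pf_of_mem_famMid {W : Finset G} {r : ℕ} {H : Finset G × Finset G × Finset G}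
    (hH : H ∈ famMid W r) : PF H.1 H.2.1 H.2.2 := by
  simp only [famMid, mem_image] at hH
  obtain ⟨p, hp, rfl⟩ := hH
  exact pf_of_mem_hullPairs hp

theorem pf_of_mem_famFirst {W : Finset G} {r : ℕ} {H : Finset G × Finset G × Finset G}
    (hH : H ∈ famFirst W r) : PF H.1 H.2.1 H.2.2 := by
  simp only [famFirst, mem_image] at hH
  obtain ⟨p, hp, rfl⟩ := hH
  have h := pf_of_mem_hullPairs hp
  intro w hw y hy hwy
  simp only [Finset.mem_inv'] at hy hwy
  have := h _ hy _ (Finset.inv_mem_inv hw)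
  rw [mul_inv_rev] at hwy
  exact this hwy

theorem pf_of_mem_famThird {W : Finset G} {r : ℕ} {H : Finset G × Finset G × Finset G}
    (hH : H ∈ famThird W r) : PF H.1 H.2.1 H.2.2 := by
  simp only [famThird, mem_image] at hH
  obtain ⟨p, hp, rfl⟩ := hH
  have h := pf_of_mem_hullPairs hp
  intro a ha b hb hab
  simp only [Finset.mem_inv'] at ha
  have := h _ ha _ hab
  rw [inv_mul_cancel_left] at this
  exact this hb

theorem capture_famMid {W : Finset G} {r : ℕ} (hr : (convMatrix W).rank ≤ r)
    {X Z : Finset G} (hPF : PF X W Z) :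
    ∃ H ∈ famMid W r, X ⊆ H.1 ∧ H.2.1 = W ∧ Z ⊆ H.2.2 := by
  obtain ⟨p, hp, hX, hZ⟩ := exists_mem_hullPairs hr hPF
  exact ⟨(p.1, W, p.2), mem_image_of_mem _ hp, hX, rfl, hZ⟩

theorem capture_famFirst {W : Finset G} {r : ℕ} (hr : (convMatrix W⁻¹).rank ≤ r)
    {Y Z : Finset G} (hPF : PF W Y Z) :
    ∃ H ∈ famFirst W r, H.1 = W ∧ Y ⊆ H.2.1 ∧ Z ⊆ H.2.2 := by
  have hPF' : PF Y⁻¹ W⁻¹ Z⁻¹ := by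
    intro a ha b hb hab
    simp only [Finset.mem_inv'] at ha hb hab
    have := hPF _ hb _ ha
    rw [mul_inv_rev] at hab
    exact this hab
  obtain ⟨p, hp, hY, hZ⟩ := exists_mem_hullPairs hr hPF'
  refine ⟨(W, p.1⁻¹, p.2⁻¹), mem_image_of_mem _ hp, rfl, ?_, ?_⟩
  · intro y hy
    rw [Finset.mem_inv']
    exact hY (Finset.inv_mem_inv hy)
  · intro z hz
    rw [Finset.mem_inv']
    exact hZ (Finset.inv_mem_inv hz)

theorem capture_famThird {W : Finset G} {r : ℕ} (hr : (convMatrix W).rank ≤ r)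
    {X Y : Finset G} (hPF : PF X Y W) :
    ∃ H ∈ famThird W r, X ⊆ H.1 ∧ Y ⊆ H.2.1 ∧ H.2.2 = W := by
  have hPF' : PF X⁻¹ W Y := by
    intro a ha b hb hab
    simp only [Finset.mem_inv'] at ha
    have := hPF _ ha _ hab
    rw [inv_mul_cancel_left] at this
    exact this hb
  obtain ⟨p, hp, hX, hY⟩ := exists_mem_hullPairs hr hPF'
  refine ⟨(p.1⁻¹, p.2, W), mem_image_of_mem _ hp, ?_, hY, rfl⟩
  intro x hx
  rw [Finset.mem_inv']
  exact hX (Finset.inv_mem_inv hx)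

/-- Rank from left invariance `K W = W`: rows of `A_W` are constant on left cosets `xK`. -/
theorem rank_le_index_of_left_invariant (K : Subgroup G) (W : Finset G)
    (hW : ∀ k ∈ K, ∀ w ∈ W, k * w ∈ W) :
    (convMatrix W).rank ≤ K.index := by
  classical
  set A := convMatrix W with hA
  have hrow : ∀ x y : G, x⁻¹ * y ∈ K → A x = A y := by
    intro x y hxy
    ext z
    simp only [hA, convMatrix_apply]
    have e : y⁻¹ * z = (x⁻¹ * y)⁻¹ * (x⁻¹ * z) := by group
    have hiff : x⁻¹ * z ∈ W ↔ y⁻¹ * z ∈ W := by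
      constructor
      · intro h; rw [e]; exact hW _ (K.inv_mem hxy) _ h
      · intro h
        have := hW _ hxy _ h
        simpa [mul_assoc] using this
    simp [hiff]
  let Abar : G ⧸ K → (G → ℚ) := Quotient.lift (s := QuotientGroup.leftRel K) A (by
    intro x y hxy
    exact hrow x y (QuotientGroup.leftRel_apply.mp hxy))
  have hrange : Set.range A.row ⊆ Set.range Abar := by
    rintro v ⟨x, rfl⟩
    exact ⟨(x : G ⧸ K), rfl⟩
  rw [Matrix.rank_eq_finrank_span_row]
  set T : Finset (G → ℚ) := (univ : Finset (G ⧸ K)).image Abar with hTdef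
  have hT : Set.range Abar = (T : Set (G → ℚ)) := by
    rw [hTdef, coe_image, coe_univ, Set.image_univ]
  calc Module.finrank ℚ (Submodule.span ℚ (Set.range A.row))
      ≤ Module.finrank ℚ (Submodule.span ℚ (Set.range Abar)) :=
        Submodule.finrank_mono (Submodule.span_mono hrange)
    _ = Module.finrank ℚ (Submodule.span ℚ (T : Set (G → ℚ))) := by rw [hT]
    _ ≤ T.card := by
        have := finrank_span_le_card (R := ℚ) (T : Set (G → ℚ))
        simpa using this
    _ ≤ Fintype.card (G ⧸ K) := card_image_le.trans (by simp)
    _ = K.index := by rw [Subgroup.index_eq_card, Nat.card_eq_fintype_card]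

/-- Rank from right invariance `W K = W`: columns of `A_W` are constant on left cosets `zK`. -/
theorem rank_le_index_of_right_invariant (K : Subgroup G) (W : Finset G)
    (hW : ∀ w ∈ W, ∀ k ∈ K, w * k ∈ W) :
    (convMatrix W).rank ≤ K.index := by
  classical
  have hT : Matrix.transpose (convMatrix W) = convMatrix (W.image (·⁻¹)) := by
    ext z x
    simp only [Matrix.transpose_apply, convMatrix_apply, mem_image]
    have hiff : x⁻¹ * z ∈ W ↔ ∃ w ∈ W, w⁻¹ = z⁻¹ * x := by
      constructor
      · intro h; exact ⟨_, h, by group⟩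
      · rintro ⟨w, hw, he⟩
        have : w = x⁻¹ * z := by
          have := congrArg (·⁻¹) he; simpa using this
        rwa [this] at hw
    simp [hiff]
  rw [← Matrix.rank_transpose, hT]
  apply rank_le_index_of_left_invariant
  intro k hk w hw
  rw [mem_image] at hw ⊢
  obtain ⟨w₀, hw₀, rfl⟩ := hw
  exact ⟨w₀ * k⁻¹, hW _ hw₀ _ (K.inv_mem hk), by group⟩

end rankHulls

/-! ## The Young-subgroup sets `WR`, `WL`: rank ≤ orbit size, inverses swap them -/

section young
open Pointwise
variable {n : ℕ}

theorem mem_WR {c : Fin n → Fin n} {𝒟 : Finset (Lab n)} {σ : Equiv.Perm (Fin n)} :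
    σ ∈ WR c 𝒟 ↔ ρR c σ ∈ 𝒟 := by simp [WR]
theorem mem_WL {c : Fin n → Fin n} {𝒟 : Finset (Lab n)} {σ : Equiv.Perm (Fin n)} :
    σ ∈ WL c 𝒟 ↔ ρL c σ ∈ 𝒟 := by simp [WL]

theorem ρR_inv (c : Fin n → Fin n) (σ : Equiv.Perm (Fin n)) : ρR c σ⁻¹ = ρL c σ := by
  simp only [ρR, ρL, inv_inv, Equiv.Perm.sign_inv]
theorem ρL_inv (c : Fin n → Fin n) (σ : Equiv.Perm (Fin n)) : ρL c σ⁻¹ = ρR c σ := by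
  simp only [ρR, ρL, Equiv.Perm.sign_inv]

theorem image_ρL_eq (c : Fin n → Fin n) :
    (univ : Finset (Equiv.Perm (Fin n))).image (ρL c) = univ.image (ρR c) := by
  ext d
  simp only [mem_image, mem_univ, true_and]
  constructor
  · rintro ⟨σ, rfl⟩; exact ⟨σ⁻¹, ρR_inv c σ⟩
  · rintro ⟨σ, rfl⟩; exact ⟨σ⁻¹, ρL_inv c σ⟩

theorem inv_WR (c : Fin n → Fin n) (𝒟 : Finset (Lab n)) : (WR c 𝒟)⁻¹ = WL c 𝒟 := by
  ext σ; rw [Finset.mem_inv', mem_WR, mem_WL, ρR_inv]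
theorem inv_WL (c : Fin n → Fin n) (𝒟 : Finset (Lab n)) : (WL c 𝒟)⁻¹ = WR c 𝒟 := by
  ext σ; rw [Finset.mem_inv', mem_WR, mem_WL, ρL_inv]

theorem rank_WR_le (c : Fin n → Fin n) (𝒟 : Finset (Lab n)) :
    (convMatrix (WR c 𝒟)).rank ≤ orbitCard c := by
  apply rank_le_card_image_of_cols (convMatrix (WR c 𝒟)) (ρR c)
    (fun d => fun x => if ((fun i => d.1 (x i)), Equiv.Perm.sign x⁻¹ * d.2) ∈ 𝒟 then (1 : ℚ) else 0)
  intro z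
  funext x
  have e : ρR c (x⁻¹ * z) = ((fun i => (ρR c z).1 (x i)), Equiv.Perm.sign x⁻¹ * (ρR c z).2) := by
    simp only [ρR, mul_inv_rev, inv_inv, Equiv.Perm.mul_apply, map_mul]
  simp only [convMatrix_apply, mem_WR, e]

theorem rank_WL_le (c : Fin n → Fin n) (𝒟 : Finset (Lab n)) :
    (convMatrix (WL c 𝒟)).rank ≤ orbitCard c := by
  apply rank_le_card_image_of_rows (convMatrix (WL c 𝒟)) (ρR c)
    (fun d => fun z => if ((fun i => d.1 (z i)), d.2 * Equiv.Perm.sign z) ∈ 𝒟 then (1 : ℚ) else 0)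
  intro x
  funext z
  have e : ρL c (x⁻¹ * z) = ((fun i => (ρR c x).1 (z i)), (ρR c x).2 * Equiv.Perm.sign z) := by
    simp only [ρR, ρL, Equiv.Perm.mul_apply, map_mul, Equiv.Perm.sign_inv]
  simp only [convMatrix_apply, mem_WL, e]

theorem subset_satRight (c : Fin n → Fin n) (S₀ : Finset (Equiv.Perm (Fin n))) :
    S₀ ⊆ satRight c S₀ := fun _ hσ => mem_WR.mpr (mem_image_of_mem _ hσ)
theorem subset_satLeft (c : Fin n → Fin n) (S₀ : Finset (Equiv.Perm (Fin n))) :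
    S₀ ⊆ satLeft c S₀ := fun _ hσ => mem_WL.mpr (mem_image_of_mem _ hσ)

/-- The six hull families attached to `(c, 𝒟)`. -/
def six (c : Fin n → Fin n) (𝒟 : Finset (Lab n)) (r : ℕ) :
    Finset (Finset (Equiv.Perm (Fin n)) × Finset (Equiv.Perm (Fin n)) × Finset (Equiv.Perm (Fin n))) :=
  ((famMid (WR c 𝒟) r ∪ famMid (WL c 𝒟) r) ∪ (famFirst (WR c 𝒟) r ∪ famFirst (WL c 𝒟) r)) ∪
    (famThird (WR c 𝒟) r ∪ famThird (WL c 𝒟) r)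

theorem card_six_le (c : Fin n → Fin n) (𝒟 : Finset (Lab n)) (r : ℕ) :
    (six c 𝒟 r).card ≤ 6 * (Fintype.card (Equiv.Perm (Fin n)) + 1) ^ r := by
  have h1 := card_famMid_le (WR c 𝒟) r
  have h2 := card_famMid_le (WL c 𝒟) r
  have h3 := card_famFirst_le (WR c 𝒟) r
  have h4 := card_famFirst_le (WL c 𝒟) r
  have h5 := card_famThird_le (WR c 𝒟) r
  have h6 := card_famThird_le (WL c 𝒟) r
  calc (six c 𝒟 r).card
      ≤ ((famMid (WR c 𝒟) r ∪ famMid (WL c 𝒟) r) ∪ (famFirst (WR c 𝒟) r ∪ famFirst (WL c 𝒟) r)).card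
          + (famThird (WR c 𝒟) r ∪ famThird (WL c 𝒟) r).card := card_union_le _ _
    _ ≤ ((famMid (WR c 𝒟) r ∪ famMid (WL c 𝒟) r).card + (famFirst (WR c 𝒟) r ∪ famFirst (WL c 𝒟) r).card)
          + (famThird (WR c 𝒟) r ∪ famThird (WL c 𝒟) r).card :=
        Nat.add_le_add_right (card_union_le _ _) _
    _ ≤ (((famMid (WR c 𝒟) r).card + (famMid (WL c 𝒟) r).card) +
          ((famFirst (WR c 𝒟) r).card + (famFirst (WL c 𝒟) r).card)) +
          ((famThird (WR c 𝒟) r).card + (famThird (WL c 𝒟) r).card) :=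
        Nat.add_le_add (Nat.add_le_add (card_union_le _ _) (card_union_le _ _)) (card_union_le _ _)
    _ ≤ 6 * (Fintype.card (Equiv.Perm (Fin n)) + 1) ^ r := by omega

theorem pf_of_mem_six {c : Fin n → Fin n} {𝒟 : Finset (Lab n)} {r : ℕ}
    {H : Finset (Equiv.Perm (Fin n)) × Finset (Equiv.Perm (Fin n)) × Finset (Equiv.Perm (Fin n))}
    (hH : H ∈ six c 𝒟 r) : PF H.1 H.2.1 H.2.2 := by
  simp only [six, mem_union] at hH
  rcases hH with ((h | h) | (h | h)) | (h | h)
  · exact pf_of_mem_famMid h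
  · exact pf_of_mem_famMid h
  · exact pf_of_mem_famFirst h
  · exact pf_of_mem_famFirst h
  · exact pf_of_mem_famThird h
  · exact pf_of_mem_famThird h

/-- The budget exponent `r₀ = ⌊√(n!)/(2 n^{C+2} ln n)⌋`. -/
noncomputable def rBound (n : ℕ) (C : ℝ) : ℕ :=
  ⌊Real.sqrt (n.factorial : ℝ) / (2 * (n : ℝ) ^ (C + 2) * Real.log n)⌋₊

/-- The whole hull family at `n`. -/
noncomputable def bigFam (n : ℕ) (C : ℝ) :
    Finset (Finset (Equiv.Perm (Fin n)) × Finset (Equiv.Perm (Fin n)) × Finset (Equiv.Perm (Fin n))) :=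
  ((univ : Finset (Fin n → Fin n)).filter (fun c => orbitCard c ≤ rBound n C)).biUnion (fun c =>
    ((univ : Finset (Equiv.Perm (Fin n))).image (ρR c)).powerset.biUnion (fun 𝒟 =>
      six c 𝒟 (rBound n C)))

theorem pf_of_mem_bigFam {C : ℝ}
    {H : Finset (Equiv.Perm (Fin n)) × Finset (Equiv.Perm (Fin n)) × Finset (Equiv.Perm (Fin n))}
    (hH : H ∈ bigFam n C) : PF H.1 H.2.1 H.2.2 := by
  simp only [bigFam, mem_biUnion] at hH
  obtain ⟨c, -, 𝒟, -, h⟩ := hH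
  exact pf_of_mem_six h

theorem card_bigFam_le (C : ℝ) :
    (bigFam n C).card ≤ Fintype.card (Fin n → Fin n) * (2 ^ rBound n C *
      (6 * (Fintype.card (Equiv.Perm (Fin n)) + 1) ^ rBound n C)) := by
  unfold bigFam
  set r := rBound n C with hr
  set B := 2 ^ r * (6 * (Fintype.card (Equiv.Perm (Fin n)) + 1) ^ r) with hB
  have inner : ∀ c ∈ (univ : Finset (Fin n → Fin n)).filter (fun c => orbitCard c ≤ r),
      (((univ : Finset (Equiv.Perm (Fin n))).image (ρR c)).powerset.biUnion
        (fun 𝒟 => six c 𝒟 r)).card ≤ B := by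
    intro c hc
    rw [mem_filter] at hc
    calc (((univ : Finset (Equiv.Perm (Fin n))).image (ρR c)).powerset.biUnion
            (fun 𝒟 => six c 𝒟 r)).card
        ≤ ∑ 𝒟 ∈ ((univ : Finset (Equiv.Perm (Fin n))).image (ρR c)).powerset, (six c 𝒟 r).card :=
          card_biUnion_le
      _ ≤ ∑ _𝒟 ∈ ((univ : Finset (Equiv.Perm (Fin n))).image (ρR c)).powerset,
            6 * (Fintype.card (Equiv.Perm (Fin n)) + 1) ^ r :=
          sum_le_sum (fun 𝒟 _ => card_six_le c 𝒟 r)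
      _ = 2 ^ (orbitCard c) * (6 * (Fintype.card (Equiv.Perm (Fin n)) + 1) ^ r) := by
          rw [sum_const, card_powerset, smul_eq_mul]; rfl
      _ ≤ B := Nat.mul_le_mul_right _ (Nat.pow_le_pow_right (by norm_num) hc.2)
  calc (((univ : Finset (Fin n → Fin n)).filter (fun c => orbitCard c ≤ r)).biUnion (fun c =>
          ((univ : Finset (Equiv.Perm (Fin n))).image (ρR c)).powerset.biUnion (fun 𝒟 => six c 𝒟 r))).card
      ≤ ∑ c ∈ (univ : Finset (Fin n → Fin n)).filter (fun c => orbitCard c ≤ r),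
          (((univ : Finset (Equiv.Perm (Fin n))).image (ρR c)).powerset.biUnion (fun 𝒟 => six c 𝒟 r)).card :=
        card_biUnion_le
    _ ≤ ∑ _c ∈ (univ : Finset (Fin n → Fin n)).filter (fun c => orbitCard c ≤ r), B := sum_le_sum inner
    _ = ((univ : Finset (Fin n → Fin n)).filter (fun c => orbitCard c ≤ r)).card * B := by
        rw [sum_const, smul_eq_mul]
    _ ≤ Fintype.card (Fin n → Fin n) * B :=
        Nat.mul_le_mul_right _ ((card_filter_le _ _).trans (card_univ (α := Fin n → Fin n)).le)

section memSix
variable {c : Fin n → Fin n} {𝒟 : Finset (Lab n)} {r : ℕ}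
  {H : Finset (Equiv.Perm (Fin n)) × Finset (Equiv.Perm (Fin n)) × Finset (Equiv.Perm (Fin n))}
theorem mem_six_1 (h : H ∈ famMid (WR c 𝒟) r) : H ∈ six c 𝒟 r := by
  unfold six; exact mem_union_left _ (mem_union_left _ (mem_union_left _ h))
theorem mem_six_2 (h : H ∈ famMid (WL c 𝒟) r) : H ∈ six c 𝒟 r := by
  unfold six; exact mem_union_left _ (mem_union_left _ (mem_union_right _ h))
theorem mem_six_3 (h : H ∈ famFirst (WR c 𝒟) r) : H ∈ six c 𝒟 r := by
  unfold six; exact mem_union_left _ (mem_union_right _ (mem_union_left _ h))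
theorem mem_six_4 (h : H ∈ famFirst (WL c 𝒟) r) : H ∈ six c 𝒟 r := by
  unfold six; exact mem_union_left _ (mem_union_right _ (mem_union_right _ h))
theorem mem_six_5 (h : H ∈ famThird (WR c 𝒟) r) : H ∈ six c 𝒟 r := by
  unfold six; exact mem_union_right _ (mem_union_left _ h)
theorem mem_six_6 (h : H ∈ famThird (WL c 𝒟) r) : H ∈ six c 𝒟 r := by
  unfold six; exact mem_union_right _ (mem_union_right _ h)
end memSix

/-- membership of a `six`-hull in `bigFam`. -/
theorem mem_bigFam {C : ℝ} {c : Fin n → Fin n} (hc : orbitCard c ≤ rBound n C)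
    {𝒟 : Finset (Lab n)} (h𝒟 : 𝒟 ⊆ (univ : Finset (Equiv.Perm (Fin n))).image (ρR c))
    {H : Finset (Equiv.Perm (Fin n)) × Finset (Equiv.Perm (Fin n)) × Finset (Equiv.Perm (Fin n))}
    (hH : H ∈ six c 𝒟 (rBound n C)) : H ∈ bigFam n C := by
  simp only [bigFam, mem_biUnion, mem_filter, mem_univ, true_and, mem_powerset]
  exact ⟨c, hc, 𝒟, h𝒟, hH⟩

end young

/-! ## Budget arithmetic -/

section budget

/-- Polynomials are eventually dominated by the factorial (copied from the skeleton). -/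
theorem factorial_dominates (A : ℝ) (j : ℕ) :
    ∃ N : ℕ, ∀ n ≥ N, A * (n : ℝ) ^ j ≤ (n.factorial : ℝ) := by
  refine ⟨2 * (j + 1) + ⌈A * 2 ^ (j + 1)⌉₊, fun n hn => ?_⟩
  have hj : j + 1 ≤ n := by omega
  have hfac : (n - (j + 1) + 1) ^ (j + 1) ≤ n.factorial := by
    have h := @Nat.factorial_mul_pow_le_factorial (n - (j + 1)) (j + 1)
    rw [Nat.sub_add_cancel hj] at h
    exact le_trans (Nat.le_mul_of_pos_left _ (Nat.factorial_pos _)) h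
  have hq : (n : ℝ) / 2 ≤ ((n - (j + 1) + 1 : ℕ) : ℝ) := by
    have e : (n - (j + 1) + 1 : ℕ) = n - j := by omega
    rw [e, Nat.cast_sub (by omega)]
    have h2 : ((2 * j : ℕ) : ℝ) ≤ n := by exact_mod_cast (show 2 * j ≤ n by omega)
    push_cast at h2
    linarith
  have hA : A * 2 ^ (j + 1) ≤ n := by
    have h1 : A * 2 ^ (j + 1) ≤ ⌈A * 2 ^ (j + 1)⌉₊ := Nat.le_ceil _
    have h2 : ((⌈A * 2 ^ (j + 1)⌉₊ : ℕ) : ℝ) ≤ n := by exact_mod_cast (show ⌈A * 2 ^ (j + 1)⌉₊ ≤ n by omega)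
    exact h1.trans h2
  have hn0 : (0 : ℝ) ≤ n := Nat.cast_nonneg n
  calc A * (n : ℝ) ^ j ≤ ((n : ℝ) / 2 ^ (j + 1)) * (n : ℝ) ^ j := by
        apply mul_le_mul_of_nonneg_right _ (by positivity)
        rw [le_div_iff₀ (by positivity)]
        exact hA
    _ = ((n : ℝ) / 2) ^ (j + 1) := by rw [div_pow, pow_succ]; ring
    _ ≤ (((n - (j + 1) + 1 : ℕ) : ℝ)) ^ (j + 1) := pow_le_pow_left₀ (by positivity) hq _
    _ ≤ (n.factorial : ℝ) := by exact_mod_cast hfac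

/-- The budget inequality: `n^n · 2^r · 6 (n!+1)^r ≤ exp(√(n!)/n^{C+1})` eventually, `r = rBound n C`. -/
theorem budget (C : ℝ) : ∃ N₀ : ℕ, ∀ n ≥ N₀,
    ((Fintype.card (Fin n → Fin n) * (2 ^ rBound n C *
      (6 * (Fintype.card (Equiv.Perm (Fin n)) + 1) ^ rBound n C)) : ℕ) : ℝ) ≤
      Real.exp (Real.sqrt (n.factorial : ℝ) / (n : ℝ) ^ (C + 1)) := by
  obtain ⟨k, hk⟩ : ∃ k : ℕ, 2 * C + 6 ≤ k := ⟨⌈2 * C + 6⌉₊, Nat.le_ceil _⟩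
  obtain ⟨N, hN⟩ := factorial_dominates 64 k
  refine ⟨max N 16, fun n hn => ?_⟩
  have hNn : N ≤ n := le_trans (le_max_left _ _) hn
  have h16 : 16 ≤ n := le_trans (le_max_right _ _) hn
  -- notation
  have hn16 : (16 : ℝ) ≤ n := by exact_mod_cast h16
  have hn0 : (0 : ℝ) < n := by linarith
  have hn1 : (1 : ℝ) ≤ n := by linarith
  set F : ℝ := (n.factorial : ℝ) with hF
  set s : ℝ := Real.sqrt F with hs
  set L : ℝ := Real.log n with hL
  set P : ℝ := (n : ℝ) ^ (C + 1) with hP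
  set r : ℕ := rBound n C with hr
  have hF0 : 0 < F := by rw [hF]; exact_mod_cast n.factorial_pos
  have hs0 : 0 < s := Real.sqrt_pos.mpr hF0
  have hP0 : 0 < P := Real.rpow_pos_of_pos hn0 _
  have he2 : Real.exp 2 ≤ 16 := by
    have h1 := Real.exp_one_lt_d9
    have : Real.exp 2 = Real.exp 1 * Real.exp 1 := by rw [← Real.exp_add]; norm_num
    rw [this]; nlinarith [Real.exp_pos 1]
  have hL2 : 2 ≤ L := by
    rw [hL]
    have h16' : (2 : ℝ) ≤ Real.log 16 := (Real.le_log_iff_exp_le (by norm_num)).mpr he2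
    exact h16'.trans (Real.log_le_log (by norm_num) hn16)
  have hL0 : 0 < L := by linarith
  have hLn : L ≤ n := by
    rw [hL]; have := Real.log_le_sub_one_of_pos hn0; linarith
  -- the exponent pieces
  have hPn : (n : ℝ) ^ (C + 2) = P * n := by
    rw [hP, show C + 2 = (C + 1) + 1 by ring, Real.rpow_add hn0, Real.rpow_one]
  have hq0 : 0 ≤ s / (2 * (n : ℝ) ^ (C + 2) * L) := by positivity
  have hrq : (r : ℝ) ≤ s / (2 * (n : ℝ) ^ (C + 2) * L) := by
    rw [hr]; exact Nat.floor_le hq0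
  -- (a) lower-order terms: log 6 + n L ≤ s / (4P)
  have hsbig : 8 * (n : ℝ) ^ (C + 3) ≤ s := by
    rw [hs]
    apply Real.le_sqrt_of_sq_le
    have h1 : (n : ℝ) ^ (2 * C + 6) ≤ (n : ℝ) ^ (k : ℝ) :=
      Real.rpow_le_rpow_of_exponent_le hn1 hk
    rw [Real.rpow_natCast] at h1
    have h2 : 64 * (n : ℝ) ^ k ≤ F := hN n hNn
    have e : (8 * (n : ℝ) ^ (C + 3)) ^ 2 = 64 * (n : ℝ) ^ (2 * C + 6) := by
      rw [mul_pow, sq ((n:ℝ) ^ (C + 3)), ← Real.rpow_add hn0]; ring_nf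
    rw [e]; linarith
  have hP3 : (n : ℝ) ^ (C + 3) = P * n ^ 2 := by
    rw [hP, show C + 3 = (C + 1) + 2 by ring, Real.rpow_add hn0]
    norm_num
  have ha : Real.log 6 + n * L ≤ s / (4 * P) := by
    rw [le_div_iff₀ (by positivity)]
    have hlog6 : Real.log 6 < 2 := by
      have : Real.log 6 < Real.log (Real.exp 2) := by
        apply Real.log_lt_log (by norm_num)
        have h1 := Real.exp_one_gt_d9
        have : Real.exp 2 = Real.exp 1 * Real.exp 1 := by rw [← Real.exp_add]; norm_num
        rw [this]; nlinarith
      rwa [Real.log_exp] at this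
    have : (Real.log 6 + n * L) * (4 * P) ≤ (2 * n ^ 2) * (4 * P) := by
      apply mul_le_mul_of_nonneg_right _ (by positivity)
      nlinarith
    rw [hP3] at hsbig
    nlinarith
  -- (b) r (log 2 + log (n!+1)) ≤ s/(2P) + s/(4P)
  have hlogF : Real.log (F + 1) ≤ Real.log 2 + n * L := by
    have hFle : F ≤ (n : ℝ) ^ n := by
      rw [hF]; exact_mod_cast Nat.factorial_le_pow n
    have h1 : F + 1 ≤ 2 * (n : ℝ) ^ n := by
      have : (1 : ℝ) ≤ (n : ℝ) ^ n := one_le_pow₀ hn1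
      linarith
    calc Real.log (F + 1) ≤ Real.log (2 * (n : ℝ) ^ n) := Real.log_le_log (by linarith) h1
      _ = Real.log 2 + n * L := by
          rw [Real.log_mul (by norm_num) (by positivity), Real.log_pow, hL]
  have hlog2 : Real.log 2 < 1 := by
    have := Real.log_two_lt_d9; linarith
  have hlog2pos : 0 < Real.log 2 := Real.log_pos (by norm_num)
  have hb : (r : ℝ) * (Real.log 2 + Real.log (F + 1)) ≤ s / (2 * P) + s / (4 * P) := by
    have h1 : (r : ℝ) * (Real.log 2 + Real.log (F + 1)) ≤
        (s / (2 * (n : ℝ) ^ (C + 2) * L)) * (2 + n * L) := by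
      apply mul_le_mul hrq _ (add_nonneg hlog2pos.le (Real.log_nonneg (by linarith))) hq0
      linarith
    have h2 : (s / (2 * (n : ℝ) ^ (C + 2) * L)) * (2 + n * L) = s / (2 * P) + s / (P * (n * L)) := by
      rw [hPn]; field_simp; ring
    have h3 : s / (P * (n * L)) ≤ s / (4 * P) := by
      have h4 : (4 : ℝ) ≤ n * L := by nlinarith [hL2, hn16]
      apply div_le_div_of_nonneg_left hs0.le (mul_pos (by norm_num) hP0)
      calc 4 * P ≤ (n * L) * P := mul_le_mul_of_nonneg_right h4 hP0.le
        _ = P * (n * L) := by ring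
    linarith
  -- assemble: log LHS ≤ s/P
  have hcardfun : (Fintype.card (Fin n → Fin n) : ℝ) = (n : ℝ) ^ n := by
    rw [Fintype.card_fun, Fintype.card_fin]; push_cast; ring
  have hcardperm : (Fintype.card (Equiv.Perm (Fin n)) : ℝ) = F := by
    rw [Fintype.card_perm, Fintype.card_fin]
  have hLHSpos : (0 : ℝ) < (n : ℝ) ^ n * (2 ^ r * (6 * (F + 1) ^ r)) := by positivity
  have hlogLHS : Real.log ((n : ℝ) ^ n * (2 ^ r * (6 * (F + 1) ^ r))) ≤ s / P := by
    rw [Real.log_mul (by positivity) (by positivity), Real.log_mul (by positivity) (by positivity),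
      Real.log_mul (by positivity) (by positivity), Real.log_pow, Real.log_pow, Real.log_pow, ← hL]
    have : s / (4 * P) + (s / (2 * P) + s / (4 * P)) = s / P := by field_simp; ring
    nlinarith [ha, hb, this]
  have key : (n : ℝ) ^ n * (2 ^ r * (6 * (F + 1) ^ r)) ≤ Real.exp (s / P) := by
    calc (n : ℝ) ^ n * (2 ^ r * (6 * (F + 1) ^ r))
        = Real.exp (Real.log ((n : ℝ) ^ n * (2 ^ r * (6 * (F + 1) ^ r)))) := (Real.exp_log hLHSpos).symm
      _ ≤ Real.exp (s / P) := Real.exp_le_exp.mpr hlogLHS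
  push_cast
  rw [hcardfun, hcardperm]
  exact key

end budget

/-! ## The reduction -/

section reduction
open Pointwise
variable {n : ℕ}

/-- capture bookkeeping: a contained coordinate is captured at 100 %. -/
theorem cap_of_subset {X H : Finset (Equiv.Perm (Fin n))} (h : X ⊆ H) : 4 * X.card ≤ 5 * (X ∩ H).card := by
  rw [inter_eq_left.mpr h]; omega

/-- capture bookkeeping: the saturated coordinate is captured at 80 %. -/
theorem cap_of_piece {X X₀ H : Finset (Equiv.Perm (Fin n))} (hX₀ : X₀ ⊆ X) (h45 : 4 * X.card ≤ 5 * X₀.card)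
    (hW : X₀ ⊆ H) : 4 * X.card ≤ 5 * (X ∩ H).card := by
  have : X₀.card ≤ (X ∩ H).card := card_le_card (subset_inter hX₀ hW)
  omega

end reduction

open scoped Pointwise in
/-- THE REDUCTION (DrefuteStubHullG2.md §3): the coset-envelope statement implies the registered
`stub_hull` conclusion (capture profile a permutation of `(4/5, 1, 1)`). -/
theorem hullFamily_of_CE80 (C : ℝ) (h : CE80 C) : HullFamily C := by
  classical
  obtain ⟨n₁, hn₁⟩ := h
  obtain ⟨N₀, hN₀⟩ := budget C
  refine ⟨max (max n₁ N₀) 2, fun n hn => ⟨bigFam n C, ?_, ?_, ?_⟩⟩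
  · exact le_trans (by exact_mod_cast card_bigFam_le C)
      (hN₀ n (le_trans (le_trans (le_max_right _ _) (le_max_left _ _)) hn))
  · intro H hH
    exact pf_of_mem_bigFam hH
  · intro X Y Z hX hY hZ hPF
    have hn₁' : n₁ ≤ n := le_trans (le_trans (le_max_left _ _) (le_max_left _ _)) hn
    have hn2 : 2 ≤ n := le_trans (le_max_right _ _) hn
    obtain ⟨c, hcidx, hcases⟩ := hn₁ n hn₁' X Y Z hX hY hZ hPF
    -- orbit bound ⇒ `orbitCard c ≤ rBound n C`
    have hc : orbitCard c ≤ rBound n C := by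
      unfold rBound
      apply Nat.le_floor
      have hn2r : (2 : ℝ) ≤ n := by exact_mod_cast hn2
      have hn0 : (0 : ℝ) < n := by linarith
      have hL : 0 < Real.log n := Real.log_pos (by linarith)
      have hpow : 0 < (n : ℝ) ^ (C + 2) := Real.rpow_pos_of_pos hn0 _
      have hden : 0 < 2 * (n : ℝ) ^ (C + 2) * Real.log n := by positivity
      rw [le_div_iff₀ hden]
      exact hcidx
    have h𝒟R : ∀ S₀ : Finset (Equiv.Perm (Fin n)),
        S₀.image (ρR c) ⊆ (univ : Finset (Equiv.Perm (Fin n))).image (ρR c) :=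
      fun S₀ => image_subset_image (subset_univ _)
    have h𝒟L : ∀ S₀ : Finset (Equiv.Perm (Fin n)),
        S₀.image (ρL c) ⊆ (univ : Finset (Equiv.Perm (Fin n))).image (ρR c) :=
      fun S₀ => (image_subset_image (subset_univ _)).trans (image_ρL_eq c).le
    have hrR : ∀ 𝒟, (convMatrix (WR c 𝒟)).rank ≤ rBound n C :=
      fun 𝒟 => (rank_WR_le c 𝒟).trans hc
    have hrL : ∀ 𝒟, (convMatrix (WL c 𝒟)).rank ≤ rBound n C :=
      fun 𝒟 => (rank_WL_le c 𝒟).trans hc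
    have hrR' : ∀ 𝒟, (convMatrix (WR c 𝒟)⁻¹).rank ≤ rBound n C :=
      fun 𝒟 => by rw [inv_WR]; exact hrL 𝒟
    have hrL' : ∀ 𝒟, (convMatrix (WL c 𝒟)⁻¹).rank ≤ rBound n C :=
      fun 𝒟 => by rw [inv_WL]; exact hrR 𝒟
    rcases hcases with ⟨X₀, hX₀, h45, hsat | hsat⟩ | ⟨Y₀, hY₀, h45, hsat | hsat⟩ |
      ⟨Z₀, hZ₀, h45, hsat | hsat⟩
    · obtain ⟨H, hH, h1, h2, h3⟩ := capture_famFirst (hrR' (X₀.image (ρR c))) hsat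
      refine ⟨H, mem_bigFam hc (h𝒟R X₀) (mem_six_3 hH), ?_, cap_of_subset h2, cap_of_subset h3⟩
      rw [h1]; exact cap_of_piece hX₀ h45 (subset_satRight c X₀)
    · obtain ⟨H, hH, h1, h2, h3⟩ := capture_famFirst (hrL' (X₀.image (ρL c))) hsat
      refine ⟨H, mem_bigFam hc (h𝒟L X₀) (mem_six_4 hH), ?_, cap_of_subset h2, cap_of_subset h3⟩
      rw [h1]; exact cap_of_piece hX₀ h45 (subset_satLeft c X₀)
    · obtain ⟨H, hH, h1, h2, h3⟩ := capture_famMid (hrR (Y₀.image (ρR c))) hsat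
      refine ⟨H, mem_bigFam hc (h𝒟R Y₀) (mem_six_1 hH), cap_of_subset h1, ?_, cap_of_subset h3⟩
      rw [h2]; exact cap_of_piece hY₀ h45 (subset_satRight c Y₀)
    · obtain ⟨H, hH, h1, h2, h3⟩ := capture_famMid (hrL (Y₀.image (ρL c))) hsat
      refine ⟨H, mem_bigFam hc (h𝒟L Y₀) (mem_six_2 hH), cap_of_subset h1, ?_, cap_of_subset h3⟩
      rw [h2]; exact cap_of_piece hY₀ h45 (subset_satLeft c Y₀)
    · obtain ⟨H, hH, h1, h2, h3⟩ := capture_famThird (hrR (Z₀.image (ρR c))) hsat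
      refine ⟨H, mem_bigFam hc (h𝒟R Z₀) (mem_six_5 hH), cap_of_subset h1, cap_of_subset h2, ?_⟩
      rw [h3]; exact cap_of_piece hZ₀ h45 (subset_satRight c Z₀)
    · obtain ⟨H, hH, h1, h2, h3⟩ := capture_famThird (hrL (Z₀.image (ρL c))) hsat
      refine ⟨H, mem_bigFam hc (h𝒟L Z₀) (mem_six_6 hH), cap_of_subset h1, cap_of_subset h2, ?_⟩
      rw [h3]; exact cap_of_piece hZ₀ h45 (subset_satLeft c Z₀)


/-- GLUE in the exact shape of the registered stub: `(∀ C, CE80 C)` proves `stub_hull` VERBATIM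
(statement copied from `Lines/transport-split-hull.lean`, lines 108–119). -/
theorem stub_hull_of_CE80 (h : ∀ C, CE80 C) (C : ℝ) : ∃ n₀ : ℕ, ∀ n ≥ n₀,
    ∃ 𝓗 : Finset (Finset (Equiv.Perm (Fin n)) × Finset (Equiv.Perm (Fin n)) ×
        Finset (Equiv.Perm (Fin n))),
      (𝓗.card : ℝ) ≤ Real.exp (Real.sqrt (n.factorial : ℝ) / (n : ℝ) ^ (C + 1)) ∧
      (∀ H ∈ 𝓗, ∀ x ∈ H.1, ∀ y ∈ H.2.1, x * y ∉ H.2.2) ∧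
      ∀ X Y Z : Finset (Equiv.Perm (Fin n)),
        (n.factorial : ℝ) ≤ (X.card : ℝ) * (n : ℝ) ^ C →
        (n.factorial : ℝ) ≤ (Y.card : ℝ) * (n : ℝ) ^ C →
        (n.factorial : ℝ) ≤ (Z.card : ℝ) * (n : ℝ) ^ C →
        (∀ x ∈ X, ∀ y ∈ Y, x * y ∉ Z) →
        ∃ H ∈ 𝓗, 4 * X.card ≤ 5 * (X ∩ H.1).card ∧ 4 * Y.card ≤ 5 * (Y ∩ H.2.1).card ∧
          4 * Z.card ≤ 5 * (Z ∩ H.2.2).card :=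
  hullFamily_of_CE80 C (h C)

end Summit.MatrixMultiplication.MatrixMultiplication.Cruxes.PolynomialSlack.TransportSplitHull.G2
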